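import Summits.QuantumFields.BalabanUV.T4Continuum.Support.RegionGaugeSlice

/-!
# T⁴ programme, spine node NE2 (U1a), sub-row Δ1 «NE2⁰-Dirichlet» — THE EXACT THREE-SOCKET SPLIT of the two-level commutator pairing of
# Bałaban's gauge-fixed letters: `⟨x, (J·Δ_a − Δ′_a·J)y⟩ = [curl] + [gauge] + [mass]` consistency pairings of the planting `J`

NE2 formalisation swarm `b2b-balaban-t4-ne2-formalise-*`, LEAF PROVER 02 (gen 7), a generic brick for the owner's (t4-ne2-p1 gen 14) item O14-b /
O14-b′ (ruling R33 (c): the commutator pairing (P) of `Support/RegionStarInjectedPairing.opNorm_injected_le_of_pairing` is to be «split along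
Δ_a(Ω₀)» into claimable pieces composed by a `pairing_add` brick).  Pure algebra on `RegionGaugeSlice.gaugeFixed C G Gs Qs Qv a =
CᴴC + G·R·Gᴴ + a·QᴴQ` (p222530) at two levels with ANY planting `J` (King's compressed `JpR` or the renormalised `JnR`):

 * **`form_gaugeFixed_pair`**: `⟨z, Δ_a y⟩ = ⟨Cz, Cy⟩ + ⟨Gᴴz, R·Gᴴy⟩ + a·⟨Qz, Qy⟩` (the bilinear form; `form_gaugeFixed` is its diagonal);
 * **`commutator_pairing_split`**: `⟨x, (J·Δ_a − Δ′_a·J)y⟩ = [⟨C·Jᴴx, C·y⟩ − ⟨C′x, C′·Jy⟩] + [⟨Gᴴ·Jᴴx, R·Gᴴy⟩ − ⟨G′ᴴx, R′·G′ᴴ·Jy⟩]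
   + [a·⟨Q·Jᴴx, Q·y⟩ − a′·⟨Q′x, Q′·Jy⟩]` — the CURL, GAUGE and MASS consistency pairings; a bound `ε_i·√E(y)·√E′(x)` on each gives (P) with
   `ε = ε_curl + ε_gauge + ε_mass` by the triangle inequality.

HONEST FRAMING (T4-DAG p. 1).  Bookkeeping ([folklore]); nothing analytic; by this seat's `DirichletStarRenormSlabNoGo` no socket design beats
`ε ≍ n_k^{−1/2}` for the renormalised planting on slabs; NE2 (U1a) NOT proved; spine 0/9 unchanged; NOT infinite volume, NOT a mass gap, NOT the
Clay problem, NOT summit progress.  HONEST DEPENDENCY: continuum YM on T⁴ ⇐ BetaPertH ∧ nine spine estimates (0/9 proved); BetaPertH ⇐ (D1) ∧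
(D4) ∧ CAP+tail; G-an2-4 gates asym, D1 and NE2/3/4.  No `sorry`.
-/

noncomputable section

open scoped BigOperators ComplexConjugate Matrix Matrix.Norms.L2Operator
open Finset

namespace Summit.QuantumFields.BalabanUV.T4Continuum.GaugeFixedPairingSplit

open Literature.MathematicalPhysics.QuantumFieldTheory.Balaban1983to89.B5Action121 (dotProduct_mulVec_eq_star_conjTranspose_mulVec)
open Summit.QuantumFields.BalabanUV.T4Continuum
open Summit.QuantumFields.BalabanUV.T4Continuum.RegionGaugeProjection (gaugeR)
open Summit.QuantumFields.BalabanUV.T4Continuum.RegionGaugeSlice (gaugeFixed)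

/-! ## The bilinear form and the three-socket split -/

section Split

variable {p q v v' w w' u uq : Type*} [Fintype p] [DecidableEq p] [Fintype q] [DecidableEq q] [Fintype v] [DecidableEq v]
  [Fintype v'] [DecidableEq v'] [Fintype w] [Fintype w'] [Fintype u] [DecidableEq u] [Fintype uq]

omit [DecidableEq v] in
/-- **THE BILINEAR FORM OF `Δ_a`**: `⟨z, Δ_a y⟩ = ⟨Cz, Cy⟩ + ⟨Gᴴz, R·Gᴴy⟩ + a·⟨Qz, Qy⟩`. [cite: Balaban1984PropagatorsI, (1.69) p.29 (shape)] [folklore] -/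
theorem form_gaugeFixed_pair (C : Matrix w v ℂ) (G : Matrix v p ℂ) (Gs : Matrix p p ℂ) (Qs : Matrix u p ℂ) (Qv : Matrix uq v ℂ) (a : ℝ)
    (z y : v → ℂ) :
    star z ⬝ᵥ (gaugeFixed C G Gs Qs Qv a *ᵥ y)
      = star (C *ᵥ z) ⬝ᵥ (C *ᵥ y) + star (Gᴴ *ᵥ z) ⬝ᵥ (gaugeR Gs Qs *ᵥ (Gᴴ *ᵥ y)) + (a : ℂ) * (star (Qv *ᵥ z) ⬝ᵥ (Qv *ᵥ y)) := by
  unfold gaugeFixed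
  rw [Matrix.add_mulVec, Matrix.add_mulVec, Matrix.smul_mulVec, dotProduct_add, dotProduct_add, dotProduct_smul, smul_eq_mul,
    ← Matrix.mulVec_mulVec, ← Matrix.mulVec_mulVec, ← Matrix.mulVec_mulVec, ← Matrix.mulVec_mulVec,
    dotProduct_mulVec_eq_star_conjTranspose_mulVec Cᴴ, Matrix.conjTranspose_conjTranspose,
    dotProduct_mulVec_eq_star_conjTranspose_mulVec G, dotProduct_mulVec_eq_star_conjTranspose_mulVec Qvᴴ,
    Matrix.conjTranspose_conjTranspose]

omit [DecidableEq v] [DecidableEq v'] in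
/-- **THE THREE-SOCKET SPLIT OF THE COMMUTATOR PAIRING**:
`⟨x, (J·Δ_a − Δ′_a·J)y⟩ = [⟨C·Jᴴx, C·y⟩ − ⟨C′x, C′·Jy⟩] + [⟨Gᴴ·Jᴴx, R·Gᴴy⟩ − ⟨G′ᴴx, R′·G′ᴴ·Jy⟩] + [a·⟨Q·Jᴴx, Q·y⟩ − a′·⟨Q′x, Q′·Jy⟩]` — the
CURL, GAUGE and MASS consistency pairings of the planting `J`. [folklore] -/
theorem commutator_pairing_split (C : Matrix w v ℂ) (G : Matrix v p ℂ) (Gs : Matrix p p ℂ) (Qs : Matrix u p ℂ) (Qv : Matrix uq v ℂ) (a : ℝ)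
    (C' : Matrix w' v' ℂ) (G' : Matrix v' q ℂ) (Gs' : Matrix q q ℂ) (Qs' : Matrix u q ℂ) (Qv' : Matrix uq v' ℂ) (a' : ℝ)
    (J : Matrix v' v ℂ) (x : v' → ℂ) (y : v → ℂ) :
    star x ⬝ᵥ ((J * gaugeFixed C G Gs Qs Qv a - gaugeFixed C' G' Gs' Qs' Qv' a' * J) *ᵥ y)
      = (star (C *ᵥ (Jᴴ *ᵥ x)) ⬝ᵥ (C *ᵥ y) - star (C' *ᵥ x) ⬝ᵥ (C' *ᵥ (J *ᵥ y)))
        + (star (Gᴴ *ᵥ (Jᴴ *ᵥ x)) ⬝ᵥ (gaugeR Gs Qs *ᵥ (Gᴴ *ᵥ y)) - star (G'ᴴ *ᵥ x) ⬝ᵥ (gaugeR Gs' Qs' *ᵥ (G'ᴴ *ᵥ (J *ᵥ y))))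
        + ((a : ℂ) * (star (Qv *ᵥ (Jᴴ *ᵥ x)) ⬝ᵥ (Qv *ᵥ y)) - (a' : ℂ) * (star (Qv' *ᵥ x) ⬝ᵥ (Qv' *ᵥ (J *ᵥ y)))) := by
  rw [Matrix.sub_mulVec, dotProduct_sub, ← Matrix.mulVec_mulVec, ← Matrix.mulVec_mulVec,
    dotProduct_mulVec_eq_star_conjTranspose_mulVec J, form_gaugeFixed_pair, form_gaugeFixed_pair]
  ring

end Split


end Summit.QuantumFields.BalabanUV.T4Continuum.GaugeFixedPairingSplit

end
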